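import Literature.Topology.FourManifolds.LatticeFormsAnisotropic
import Literature.Topology.FourManifolds.LatticeFormsNormOne
import HarnessLib

/-!
# Definite unimodular lattices of rank `≤ 5` are `± Iₙ`

Trunk T-4MAN (lattice forms); companion of `LatticeFormsAnisotropic.lean` (Hermite's bound in
rank `≤ 5`) and `LatticeFormsNormOne.lean` (Donaldson's lattice lemma). Everything here is proved;
no definition, no named fact.

The classification of (positive definite) unimodular lattices in small rank — Conway–Sloane,
*Sphere Packings, Lattices and Groups* (3rd ed. 1999), Ch. 2 §2.4 with Table 2.2: "For
`1 ≤ n ≤ 8` there is only one odd unimodular lattice, `ℤⁿ`" (and even unimodular lattices exist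
only in dimensions `≡ 0 (mod 8)`, loc. cit.), so that `b_n = 1` for `n ≤ 7` — is proved here in
the range reached by Hermite's inequality with the crude constant `(4/3)^{(n-1)/2} < 2`, i.e.
`n ≤ 5` (`LinearMap.BilinForm.exists_ne_zero_natAbs_apply_self_le_one`: a symmetric unimodular
lattice of rank `1 ≤ n ≤ 5` has `u ≠ 0` with `|u.u| ≤ 1`):

* `isDiagonalizable_of_posDef_of_finrank_le_five` (and `…negDef…`, `…isDefinite…`): a symmetric
  unimodular definite lattice of rank `≤ 5` has an orthogonal `ℤ`-basis — in a positive definite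
  lattice the small vector `u` has `u.u = 1`, so `E = ℤu ⊕ u^⊥` (Serre, *A Course in Arithmetic*,
  Ch. V §3.2 Lemma 2, `IsometryEquiv.splitUnit`) with `u^⊥` unimodular positive definite of rank
  `n - 1`, and induction;
* `equivalent_toBilin'_one_of_posDef_of_finrank_le_five`: hence `E ≅ Iₙ = n⟨1⟩`
  (`Matrix.toBilin' 1` on `ℤⁿ`), `equivalent_toBilin'_neg_one_of_negDef_of_finrank_le_five`:
  `E ≅ n⟨-1⟩`, and `equivalent_of_posDef_of_finrank_le_five`: two positive definite symmetric
  unimodular lattices of the same rank `≤ 5` are isometric (Table 2.2: `b_n = 1`);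
* `ncard_setOf_apply_self_eq_one_of_posDef_of_finrank_le_five`: such a lattice of rank `r` has
  exactly `2r` vectors of square `1` (Donaldson's count `m = r`, `LatticeFormsNormOne.lean`).

Consequence for 4-manifolds (drawn in `SmoothIntersectionFormsDonaldsonReductions.lean`): the
conclusion of Donaldson's diagonalisation theorem
(`Literature.Topology.FourManifolds.isDiagonalizable_intersectionForm_of_isDefinite`) holds for
every closed `ℤ`-oriented *topological* 4-manifold with `b₂ ≤ 5`, for arithmetic reasons alone;
the theorem has content only from `b₂ = 8` (`E₈`) on.

`ℤ`-lattices carry the canonical structure `AddCommGroup.toIntModule` (only `[AddCommGroup M]` is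
assumed) and the declarations extend the Mathlib namespace `LinearMap.BilinForm` by dot-notation
style lemmas, deliberately, exactly as the sibling lattice files do.

## Sources

* J. H. Conway, N. J. A. Sloane, *Sphere Packings, Lattices and Groups* (Grundlehren 290, 3rd ed.,
  Springer 1999), Ch. 2 §2.4 "Integral lattices and quadratic forms", Table 2.2 (held text chunks
  162–163). [ConwaySloane1999]
* J.-P. Serre, *A Course in Arithmetic* (GTM 7, 1973), Ch. V §3.2 Lemma 2. [Serre1973]
* J. W. S. Cassels, *An Introduction to the Geometry of Numbers* (1997), Ch. II §3.2 Thm. I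
  (Hermite's inequality, via `LatticeFormsAnisotropic.lean`). [Cassels1997]
-/

open Module
open LinearMap (BilinForm)

universe u

namespace LinearMap.BilinForm

/-- **Positive definite unimodular lattices of rank `≤ 5` are diagonalisable** (inductive form,
rank `≤ n ≤ 5`): Hermite's small vector `u ≠ 0`, `|u.u| ≤ 1`
(`exists_ne_zero_natAbs_apply_self_le_one`) has `u.u = 1` by positivity; split `E = ℤu ⊕ u^⊥`
(Serre, Ch. V §3.2 Lemma 2) and apply the induction hypothesis to the positive definite unimodular
lattice `u^⊥` of rank `n - 1` (Conway–Sloane 1999, Ch. 2 §2.4, Table 2.2: `ℤⁿ` is the only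
unimodular lattice for `n ≤ 7`; proved here for `n ≤ 5`).
[cite: ConwaySloane1999, Ch. 2 §2.4 Table 2.2] [cite: Serre1973, Ch. V §3.2 Lemma 2] -/
theorem isDiagonalizable_of_posDef_of_finrank_le_aux (n : ℕ) (hn5 : n ≤ 5) :
    ∀ (M : Type u) [AddCommGroup M] [Module.Finite ℤ M] [Module.Free ℤ M] (B : BilinForm ℤ M),
      finrank ℤ M ≤ n → B.IsSymm → B.IsUnimodular → B.PosDef → B.IsDiagonalizable := by
  induction n with
  | zero =>
    intro M _ _ _ B h0 _ _ _
    exact isDiagonalizable_of_finrank_le_one B (by omega)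
  | succ n ih =>
    intro M _ _ _ B hrank hB hu hp
    by_cases hM : Subsingleton M
    · exact isDiagonalizable_of_finrank_le_one B
        (by rw [Module.finrank_zero_of_subsingleton]; exact Nat.zero_le _)
    haveI : Nontrivial M := not_subsingleton_iff_nontrivial.mp hM
    -- Hermite: a vector of square `0` or `±1`; positive definiteness forces square `1`
    obtain ⟨v, hv0, hv1⟩ := exists_ne_zero_natAbs_apply_self_le_one hB hu (by omega)
    have hpos : 0 < B v v := (posDef_iff B).mp hp v hv0
    have hvabs : (B v v).natAbs = 1 := by
      have := Int.natAbs_pos.mpr hpos.ne'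
      omega
    have hv : B v v = 1 := by
      rcases Int.natAbs_eq_iff.mp hvabs with h | h <;> omega
    -- Lemma 2: `E ≅ ⟨1⟩ ⊕ v^⊥`, `v^⊥` unimodular positive definite of rank `n - 1`
    have hr : finrank ℤ M = finrank ℤ (B.orthogonal (ℤ ∙ v)) + 1 :=
      finrank_eq_finrank_orthogonal_singleton_add_one hB v hv (by norm_num)
    exact isDiagonalizable_of_restrict_orthogonal_singleton hB v hv (by norm_num)
      (ih (by omega) _ (B.restrict _) (by omega) (hB.restrict _)
        (isUnimodular_restrict_orthogonal_singleton hu hB v hv (by norm_num)) (hp.restrict _))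

section Lattice

variable {M : Type u} [AddCommGroup M] [Module.Finite ℤ M] [Module.Free ℤ M] {B : BilinForm ℤ M}

/-- **Positive definite unimodular lattices of rank `≤ 5` are diagonalisable over `ℤ`**: a
symmetric unimodular positive definite lattice of rank `≤ 5` has an orthogonal `ℤ`-basis
(Conway–Sloane 1999, Ch. 2 §2.4 with Table 2.2: "For `1 ≤ n ≤ 8` there is only one odd
unimodular lattice, `ℤⁿ`"; the range `n ≤ 5` is the one reached by Hermite's inequality,
`exists_ne_zero_natAbs_apply_self_le_one`). [cite: ConwaySloane1999, Ch. 2 §2.4 Table 2.2] -/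
theorem isDiagonalizable_of_posDef_of_finrank_le_five (hB : B.IsSymm) (hu : B.IsUnimodular)
    (hp : B.PosDef) (h5 : finrank ℤ M ≤ 5) : B.IsDiagonalizable :=
  isDiagonalizable_of_posDef_of_finrank_le_aux 5 le_rfl M B h5 hB hu hp

/-- **Negative definite unimodular lattices of rank `≤ 5` are diagonalisable over `ℤ`** (apply
the positive definite case to `-B`). [cite: ConwaySloane1999, Ch. 2 §2.4 Table 2.2] -/
theorem isDiagonalizable_of_negDef_of_finrank_le_five (hB : B.IsSymm) (hu : B.IsUnimodular)
    (hn : B.NegDef) (h5 : finrank ℤ M ≤ 5) : B.IsDiagonalizable :=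
  (isDiagonalizable_neg_iff B).mp (isDiagonalizable_of_posDef_of_finrank_le_five hB.neg hu.neg hn h5)

/-- **Definite unimodular lattices of rank `≤ 5` are diagonalisable over `ℤ`**, i.e. `≅ ± Iₙ`
(Conway–Sloane 1999, Ch. 2 §2.4, Table 2.2: `b_n = 1` for `n ≤ 7`; proved for `n ≤ 5`).
[cite: ConwaySloane1999, Ch. 2 §2.4 Table 2.2] -/
theorem isDiagonalizable_of_isDefinite_of_finrank_le_five (hB : B.IsSymm) (hu : B.IsUnimodular)
    (hd : B.IsDefinite) (h5 : finrank ℤ M ≤ 5) : B.IsDiagonalizable :=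
  hd.elim (fun hp => isDiagonalizable_of_posDef_of_finrank_le_five hB hu hp h5)
    fun hn => isDiagonalizable_of_negDef_of_finrank_le_five hB hu hn h5

/-- **`E ≅ Iₙ` in rank `n ≤ 5`.** A symmetric unimodular positive definite lattice of rank
`n ≤ 5` is isometric to the standard lattice `ℤⁿ` with the sum-of-squares form
`Matrix.toBilin' 1` (Conway–Sloane 1999, Ch. 2 §2.4: "For `1 ≤ n ≤ 8` there is only one odd
unimodular lattice, `ℤⁿ`"). [cite: ConwaySloane1999, Ch. 2 §2.4 Table 2.2] -/
theorem equivalent_toBilin'_one_of_posDef_of_finrank_le_five (hB : B.IsSymm)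
    (hu : B.IsUnimodular) (hp : B.PosDef) (h5 : finrank ℤ M ≤ 5) :
    B.Equivalent (Matrix.toBilin' (1 : Matrix (Fin (finrank ℤ M)) (Fin (finrank ℤ M)) ℤ)) :=
  (isDiagonalizable_of_posDef_of_finrank_le_five hB hu hp h5).equivalent_toBilin'_one_of_posDef
    hu hp

/-- **`E ≅ n⟨-1⟩` in rank `n ≤ 5`.** A symmetric unimodular negative definite lattice of rank
`n ≤ 5` is isometric to `ℤⁿ` with minus the sum-of-squares form, `Matrix.toBilin' (-1)`.
[cite: ConwaySloane1999, Ch. 2 §2.4 Table 2.2] -/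
theorem equivalent_toBilin'_neg_one_of_negDef_of_finrank_le_five (hB : B.IsSymm)
    (hu : B.IsUnimodular) (hn : B.NegDef) (h5 : finrank ℤ M ≤ 5) :
    B.Equivalent (Matrix.toBilin' (-1 : Matrix (Fin (finrank ℤ M)) (Fin (finrank ℤ M)) ℤ)) :=
  (isDiagonalizable_of_negDef_of_finrank_le_five hB hu hn h5).equivalent_toBilin'_neg_one_of_negDef
    hu hn

/-- **Uniqueness in rank `≤ 5`** (Conway–Sloane 1999, Table 2.2: `b_n = 1` for `n ≤ 7`, i.e.
one isometry class of unimodular lattices; proved for `n ≤ 5`): two symmetric unimodular positive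
definite lattices of the same rank `≤ 5` are isometric.
[cite: ConwaySloane1999, Ch. 2 §2.4 Table 2.2] -/
theorem equivalent_of_posDef_of_finrank_le_five {M' : Type*} [AddCommGroup M']
    [Module.Finite ℤ M'] [Module.Free ℤ M'] {B' : BilinForm ℤ M'} (hB : B.IsSymm)
    (hu : B.IsUnimodular) (hp : B.PosDef) (hB' : B'.IsSymm) (hu' : B'.IsUnimodular)
    (hp' : B'.PosDef) (h5 : finrank ℤ M ≤ 5) (hrank : finrank ℤ M = finrank ℤ M') :
    B.Equivalent B' := by
  have e := equivalent_toBilin'_one_of_posDef_of_finrank_le_five hB hu hp h5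
  have e' := equivalent_toBilin'_one_of_posDef_of_finrank_le_five hB' hu' hp' (hrank ▸ h5)
  rw [hrank] at e
  exact e.trans e'.symm

/-- **Uniqueness in rank `≤ 5`, negative definite**: two symmetric unimodular negative definite
lattices of the same rank `≤ 5` are isometric. [cite: ConwaySloane1999, Ch. 2 §2.4 Table 2.2] -/
theorem equivalent_of_negDef_of_finrank_le_five {M' : Type*} [AddCommGroup M']
    [Module.Finite ℤ M'] [Module.Free ℤ M'] {B' : BilinForm ℤ M'} (hB : B.IsSymm)
    (hu : B.IsUnimodular) (hn : B.NegDef) (hB' : B'.IsSymm) (hu' : B'.IsUnimodular)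
    (hn' : B'.NegDef) (h5 : finrank ℤ M ≤ 5) (hrank : finrank ℤ M = finrank ℤ M') :
    B.Equivalent B' := by
  have e := equivalent_toBilin'_neg_one_of_negDef_of_finrank_le_five hB hu hn h5
  have e' := equivalent_toBilin'_neg_one_of_negDef_of_finrank_le_five hB' hu' hn' (hrank ▸ h5)
  rw [hrank] at e
  exact e.trans e'.symm

/-- **Donaldson's count in rank `≤ 5`.** A symmetric unimodular positive definite lattice of rank
`r ≤ 5` has exactly `2r` vectors of square `1` (the `± eᵢ` of an orthonormal basis): the equality
case `m = r` of Donaldson's lattice lemma (`ncard_setOf_apply_self_eq_one_eq_iff`,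
Asselmeyer-Maluga–Brans 2007, Ch. 5, Lemma 5.4) holds automatically in these ranks.
[cite: ConwaySloane1999, Ch. 2 §2.4 Table 2.2] [cite: AsselmeyerMalugaBrans2007, Ch. 5 Lemma 5.4] -/
theorem ncard_setOf_apply_self_eq_one_of_posDef_of_finrank_le_five (hB : B.IsSymm)
    (hu : B.IsUnimodular) (hp : B.PosDef) (h5 : finrank ℤ M ≤ 5) :
    {x | B x x = 1}.ncard = 2 * finrank ℤ M :=
  (ncard_setOf_apply_self_eq_one_eq_iff hB hu hp).mpr
    (isDiagonalizable_of_posDef_of_finrank_le_five hB hu hp h5)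

/-- **Donaldson's count in rank `≤ 5`, negative definite mirror**: a symmetric unimodular
negative definite lattice of rank `r ≤ 5` has exactly `2r` vectors of square `-1`.
[cite: ConwaySloane1999, Ch. 2 §2.4 Table 2.2] [cite: AsselmeyerMalugaBrans2007, Ch. 5 Lemma 5.4] -/
theorem ncard_setOf_apply_self_eq_neg_one_of_negDef_of_finrank_le_five (hB : B.IsSymm)
    (hu : B.IsUnimodular) (hn : B.NegDef) (h5 : finrank ℤ M ≤ 5) :
    {x | B x x = -1}.ncard = 2 * finrank ℤ M :=
  (ncard_setOf_apply_self_eq_neg_one_eq_iff hB hu hn).mpr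
    (isDiagonalizable_of_negDef_of_finrank_le_five hB hu hn h5)

end Lattice

end LinearMap.BilinForm
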